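import Summits.Ventures.HodgeRepro2.T5UnitaryGroupCompact
import Mathlib.Analysis.Matrix.PosDef
import Mathlib.Analysis.Matrix.Spectrum
import Mathlib.LinearAlgebra.Matrix.NonsingularInverse

/-!
# Tier-5 support (seat p3, cell pub-hodge-repro2) — the isometry group of a positive definite
hermitian form is a conjugate of `U(n)`, hence compact (B1 ll. 14 / 39 for the form `V_τ` itself)

Behind route/T4-B1-p3.md v7 (sub-claim B1, FINAL) l. 14 «at every real place τ of F⁺,
U(V ⊗_{A_{F⁺},τ} ℝ) ≅ U(3) is compact» and l. 39 «U(V_τ) is the isometry group of the standard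
positive definite form on ℂ³, i.e. U(3), compact [P, Lemma B1.2.3]»: file 107 proved `U(n)`
compact for the STANDARD form; this file does it for the isometry group
`{g | gᴴ S g = S}` of ANY positive definite hermitian Gram matrix `S` (the complex Gram matrix
`H.map φ` of `V` at a real place, file 104), by exhibiting it as a conjugate of `U(n)`:

* `exists_conjTranspose_mul_self_eq`: `S = yᴴ y` with `y` invertible — from Mathlib's spectral
  theorem `S = U diag(λ) U⋆` with `λᵢ > 0`, `y := diag(√λ) U⋆`;
* `mem_isometries_iff`, `isometries_eq_image`: `gᴴ S g = S ⟺ y g y⁻¹ ∈ U(n)`, i.e.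
  `{g | gᴴ S g = S} = y⁻¹ U(n) y` — B1's «U(V_τ) ≅ U(3)»;
* `isCompact_isometries`: it is compact — the continuous image of the compact `U(n)` (file 107).

Nothing here is a display; Mathlib + own file 107. Header declaration (README §8(d)): uses an
L-value-free non-vanishing device: NO.
-/

open Matrix
open scoped ComplexOrder

namespace Summit.Ventures.HodgeRepro2.T5PosDefIsometryCompact

variable {n : Type*} [Fintype n] [DecidableEq n]

/-! ## 1. `S = yᴴ y` with `y` invertible -/

/-- A unitary matrix has an invertible determinant. -/
theorem isUnit_det_of_mem_unitaryGroup {U : Matrix n n ℂ} (hU : U ∈ Matrix.unitaryGroup n ℂ) :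
    IsUnit U.det := by
  have h : star U * U = 1 := (Unitary.mem_iff.mp hU).1
  have h' : U.det * (star U).det = 1 := by rw [mul_comm, ← det_mul, h, det_one]
  exact IsUnit.of_mul_eq_one _ h'

/-- A positive definite hermitian matrix is `yᴴ y` for an invertible `y`: from the spectral
theorem `S = U diag(λ) U⋆` with `λᵢ > 0`, take `y = diag(√λ) U⋆`. -/
theorem exists_conjTranspose_mul_self_eq {S : Matrix n n ℂ} (hS : S.PosDef) :
    ∃ y : Matrix n n ℂ, IsUnit y.det ∧ yᴴ * y = S := by
  have hspec := hS.1.spectral_theorem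
  rw [Unitary.conjStarAlgAut_apply] at hspec
  set U : Matrix n n ℂ := (hS.1.eigenvectorUnitary : Matrix n n ℂ) with hU
  have hUmem : U ∈ Matrix.unitaryGroup n ℂ := hS.1.eigenvectorUnitary.2
  set d : n → ℂ := fun i => ((Real.sqrt (hS.1.eigenvalues i) : ℝ) : ℂ) with hd
  refine ⟨diagonal d * star U, ?_, ?_⟩
  · rw [det_mul, IsUnit.mul_iff, det_diagonal]
    refine ⟨isUnit_iff_ne_zero.mpr (Finset.prod_ne_zero_iff.mpr fun i _ => ?_), ?_⟩
    · simp only [hd, ne_eq, Complex.ofReal_eq_zero]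
      exact (Real.sqrt_pos.mpr (hS.eigenvalues_pos i)).ne'
    · exact isUnit_det_of_mem_unitaryGroup (Unitary.star_mem hUmem)
  · have hdiag : (diagonal fun i => (star d) i * d i) =
        diagonal (RCLike.ofReal ∘ hS.1.eigenvalues) := by
      congr 1
      funext i
      simp only [Pi.star_apply, hd, Function.comp_apply, Complex.star_def, Complex.conj_ofReal]
      rw [← Complex.ofReal_mul, Real.mul_self_sqrt (hS.eigenvalues_pos i).le]
      rfl
    rw [conjTranspose_mul, star_eq_conjTranspose, conjTranspose_conjTranspose,
      diagonal_conjTranspose, Matrix.mul_assoc, ← Matrix.mul_assoc (diagonal _),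
      diagonal_mul_diagonal, hdiag, ← Matrix.mul_assoc, ← star_eq_conjTranspose, ← hspec]

/-! ## 2. The isometries of `S` are a conjugate of `U(n)` -/

/-- For `S = yᴴ y` with `y` invertible: `gᴴ S g = S ⟺ y g y⁻¹ ∈ U(n)`. -/
theorem mem_isometries_iff {S y : Matrix n n ℂ} (hy : IsUnit y.det) (hyS : yᴴ * y = S)
    (g : Matrix n n ℂ) : gᴴ * S * g = S ↔ y * g * y⁻¹ ∈ Matrix.unitaryGroup n ℂ := by
  have hy' : IsUnit yᴴ.det := by rw [det_conjTranspose]; exact hy.star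
  have key : star (y * g * y⁻¹) * (y * g * y⁻¹) = yᴴ⁻¹ * (gᴴ * S * g) * y⁻¹ := by
    rw [← hyS, star_eq_conjTranspose, conjTranspose_mul, conjTranspose_mul,
      conjTranspose_nonsing_inv]
    simp only [Matrix.mul_assoc]
  rw [Matrix.mem_unitaryGroup_iff', key]
  constructor
  · intro h
    rw [h, ← hyS, ← Matrix.mul_assoc, nonsing_inv_mul _ hy', Matrix.one_mul,
      mul_nonsing_inv _ hy]
  · intro h
    calc gᴴ * S * g = yᴴ * (yᴴ⁻¹ * (gᴴ * S * g) * y⁻¹) * y := by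
          rw [Matrix.mul_assoc _ _ y, nonsing_inv_mul_cancel_right _ _ hy,
            mul_nonsing_inv_cancel_left _ _ hy']
      _ = S := by rw [h, Matrix.mul_one, hyS]

/-- `{g | gᴴ S g = S} = y⁻¹ U(n) y` for `S = yᴴ y`, `y` invertible — B1's «U(V_τ) ≅ U(3)». -/
theorem isometries_eq_image {S y : Matrix n n ℂ} (hy : IsUnit y.det) (hyS : yᴴ * y = S) :
    {g : Matrix n n ℂ | gᴴ * S * g = S} =
      (fun u => y⁻¹ * u * y) '' (Matrix.unitaryGroup n ℂ : Set (Matrix n n ℂ)) := by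
  ext g
  constructor
  · intro hg
    refine ⟨y * g * y⁻¹, (mem_isometries_iff hy hyS g).mp hg, ?_⟩
    simp only [Matrix.mul_assoc, nonsing_inv_mul _ hy, Matrix.mul_one]
    exact nonsing_inv_mul_cancel_left _ _ hy
  · rintro ⟨u, hu, rfl⟩
    rw [Set.mem_setOf_eq, mem_isometries_iff hy hyS]
    have h : y * (y⁻¹ * u * y) * y⁻¹ = u := by
      simp only [Matrix.mul_assoc, mul_nonsing_inv _ hy, Matrix.mul_one]
      exact mul_nonsing_inv_cancel_left _ _ hy
    rw [h]
    exact hu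

/-! ## 3. Compactness -/

/-- B1 ll. 14 / 39 for the form itself: the isometry group of a positive definite hermitian
Gram matrix is compact (a continuous image of the compact `U(n)`, file 107). -/
theorem isCompact_isometries {S : Matrix n n ℂ} (hS : S.PosDef) :
    IsCompact {g : Matrix n n ℂ | gᴴ * S * g = S} := by
  obtain ⟨y, hy, hyS⟩ := exists_conjTranspose_mul_self_eq hS
  rw [isometries_eq_image hy hyS]
  exact T5UnitaryGroupCompact.isCompact_unitaryGroup.image
    ((continuous_const.matrix_mul continuous_id).matrix_mul continuous_const)

/-- The same, for the subtype: the isometries of `S` form a compact space. -/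
theorem compactSpace_isometries {S : Matrix n n ℂ} (hS : S.PosDef) :
    CompactSpace {g : Matrix n n ℂ // gᴴ * S * g = S} :=
  isCompact_iff_compactSpace.mp (isCompact_isometries hS)

end Summit.Ventures.HodgeRepro2.T5PosDefIsometryCompact
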